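import Mathlib.Analysis.Complex.Liouville
import Mathlib.Analysis.PSeries
import Mathlib.NumberTheory.LSeries.Deriv
import Mathlib.NumberTheory.LSeries.Dirichlet
import Literature.Analysis.Complex.BacklundArgVariation
import Literature.NumberTheory.LFunctions.EulerMaclaurinZeta
import Literature.NumberTheory.LFunctions.LevinsonMontgomery
import HarnessLib

/-!
# Levinson–Montgomery: the variation of `arg ζ` and `arg ζ'` on horizontal segments is `O(log T)`

Trunk T-ANT (NumberTheory/LFunctions). Part D2 of the decomposition of `Literature.NumberTheory.LFunctions.speiser_iff`
along Levinson–Montgomery, Acta Math. 133 (1974), §2, proof of Theorem 1 (1.1): "By a familiar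
argument based on Jensen's theorem [Titchmarsh, §9.4], we find that `arg ζ(σ+iT)` and
`arg ζ'(σ+iT)` vary by at most `O(log T)` on the interval `0 ≤ σ ≤ 1`."

We apply the tree's Backlund lemma `Literature.Analysis.Complex.abs_im_integral_logDeriv_le_backlund` (discs
centred at `6 + iT`, radii `r = 6`, `R = 13/2`) to `g = ζ` and `g = ζ'`, with

* the polynomial bound `‖ζ(w)‖ ≤ (‖w‖ + 2)³` on `Re w ≥ -1`, `‖w - 1‖ ≥ 1`
  (`Literature.NumberTheory.LFunctions.norm_riemannZeta_le_cube`, from the tree's Euler–Maclaurin bound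
  `Literature.NumberTheory.LFunctions.norm_riemannZeta_le_of_neg_one_le_re`), whence `‖ζ‖ ≤ (T+15)³` on
  `|z - (6+iT)| ≤ 7` and, by Cauchy's estimate, `‖ζ'‖ ≤ 2(T+15)³` on `|z - (6+iT)| ≤ 13/2`
  (`T ≥ 8`);
* the anchors `‖ζ(6+iT)‖ ≥ 15/16` (`Σ_{n≥2} n⁻⁶ ≤ 1/16`) and `‖ζ'(6+iT)‖ ≥ 1/200`
  (`ζ'(s) = -Σ (log n) n^{-s}`, `Σ_{n≥3} (log n) n⁻⁶ ≤ log 3/729 + log 4/512`).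

## Main results (all proved)

* `Literature.RH.lmEdgeBound A T = π (log(A (T+15)³)/log(13/12) + 1)` and `lmEdgeBound_le_log` :
  `lmEdgeBound A T ≤ 249 log T` for `1 ≤ A ≤ 512`, `T ≥ 16`.
* `Literature.NumberTheory.LFunctions.abs_im_integral_logDeriv_riemannZeta_le` — for `T ≥ 8`, `0 ≤ b ≤ 12` and `ζ ≠ 0` on
  `[0,b] × {T}`: `|Im ∫_0^b ζ'/ζ(x+iT) dx| ≤ lmEdgeBound (16/15) T`.
* `Literature.NumberTheory.LFunctions.abs_im_integral_logDeriv_deriv_riemannZeta_le` — the same for `ζ'` with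
  `lmEdgeBound 400 T`.

## References

* N. Levinson, H. L. Montgomery, *Zeros of the derivatives of the Riemann zeta-function*, Acta
  Math. 133 (1974), 49–65, §2 (proof of (1.1)).
* E. C. Titchmarsh, *The Theory of the Riemann Zeta-Function*, 2nd ed. (1986), §9.4.
-/

noncomputable section

open Complex Set MeasureTheory Filter Topology intervalIntegral Metric
open scoped Real

namespace Literature.NumberTheory.LFunctions

/-! ## Growth of `ζ` and `ζ'` on the Backlund discs -/

/-- `‖ζ(w)‖ ≤ (‖w‖ + 2)³` for `Re w ≥ -1`, `‖w - 1‖ ≥ 1` (from the Euler–Maclaurin bound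
`‖ζ(w)‖ ≤ 1/‖w-1‖ + ½ + ‖w‖/12 + ‖w‖‖w+1‖‖w+2‖/48`). [cite: Edwards1974, §6.4 eq. (1)] -/
theorem norm_riemannZeta_le_cube {w : ℂ} (hw : -1 ≤ w.re) (hw1 : 1 ≤ ‖w - 1‖) :
    ‖riemannZeta w‖ ≤ (‖w‖ + 2) ^ 3 := by
  have hw1' : w ≠ 1 := by
    intro h; rw [h, sub_self, norm_zero] at hw1; linarith
  have h := norm_riemannZeta_le_of_neg_one_le_re hw hw1'
  have h1 : 1 / ‖w - 1‖ ≤ 1 := by rw [div_le_one (by linarith)]; exact hw1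
  have h2 : ‖w + 1‖ ≤ ‖w‖ + 2 := (norm_add_le _ _).trans (by simp)
  have h3 : ‖w + 2‖ ≤ ‖w‖ + 2 := (norm_add_le _ _).trans (by simp)
  have h0 : 0 ≤ ‖w‖ := norm_nonneg w
  have h4 : ‖w‖ * ‖w + 1‖ * ‖w + 2‖ ≤ (‖w‖ + 2) ^ 3 := by
    calc ‖w‖ * ‖w + 1‖ * ‖w + 2‖ ≤ (‖w‖ + 2) * (‖w‖ + 2) * (‖w‖ + 2) := by
          gcongr; linarith
      _ = (‖w‖ + 2) ^ 3 := by ring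
  have h5 : 4 * (‖w‖ + 2) ≤ (‖w‖ + 2) ^ 3 := by
    have h6 : (4 : ℝ) ≤ (‖w‖ + 2) ^ 2 := by nlinarith
    calc 4 * (‖w‖ + 2) ≤ (‖w‖ + 2) ^ 2 * (‖w‖ + 2) := by gcongr
      _ = (‖w‖ + 2) ^ 3 := by ring
  linarith

/-- On the disc `|z - (6+iT)| ≤ 7` (`T ≥ 8`): `‖ζ(z)‖ ≤ (T+15)³`. [folklore] -/
theorem norm_riemannZeta_le_on_disc {T : ℝ} (hT : 8 ≤ T) {z : ℂ}
    (hz : z ∈ closedBall ((6 : ℂ) + T * I) 7) : ‖riemannZeta z‖ ≤ (T + 15) ^ 3 := by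
  rw [mem_closedBall, dist_eq_norm] at hz
  have him : T - 7 ≤ z.im := by
    have := abs_im_le_norm (z - (6 + T * I))
    simp at this
    rw [abs_le] at this
    linarith [this.1]
  have hre : -1 ≤ z.re := by
    have := abs_re_le_norm (z - (6 + T * I))
    simp at this
    rw [abs_le] at this
    linarith [this.1]
  have h1 : 1 ≤ ‖z - 1‖ := by
    have := abs_im_le_norm (z - 1)
    simp at this
    have : 1 ≤ |z.im| := by rw [le_abs]; left; linarith
    linarith
  have hnorm : ‖z‖ ≤ T + 13 := by
    have e : z = (z - (6 + T * I)) + (6 + T * I) := by ring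
    have hc : ‖(6 : ℂ) + T * I‖ ≤ 6 + T := by
      refine (norm_add_le _ _).trans ?_
      simp [abs_of_nonneg (by linarith : (0 : ℝ) ≤ T)]
    calc ‖z‖ = ‖(z - (6 + T * I)) + (6 + T * I)‖ := by rw [← e]
      _ ≤ ‖z - (6 + T * I)‖ + ‖(6 : ℂ) + T * I‖ := norm_add_le _ _
      _ ≤ 7 + (6 + T) := add_le_add hz hc
      _ = T + 13 := by ring
  calc ‖riemannZeta z‖ ≤ (‖z‖ + 2) ^ 3 := norm_riemannZeta_le_cube hre h1
    _ ≤ (T + 13 + 2) ^ 3 := by gcongr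
    _ = (T + 15) ^ 3 := by ring

/-- On the disc `|z - (6+iT)| ≤ 13/2` (`T ≥ 8`): `‖ζ'(z)‖ ≤ 2(T+15)³` (Cauchy's estimate on the
circle of radius `½` about `z`, which stays in the disc of radius `7`). [folklore] -/
theorem norm_deriv_riemannZeta_le_on_disc {T : ℝ} (hT : 8 ≤ T) {z : ℂ}
    (hz : z ∈ closedBall ((6 : ℂ) + T * I) (13 / 2)) :
    ‖deriv riemannZeta z‖ ≤ 2 * (T + 15) ^ 3 := by
  have hsub : closedBall z (1 / 2) ⊆ closedBall ((6 : ℂ) + T * I) 7 := by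
    intro w hw
    rw [mem_closedBall] at hw hz ⊢
    linarith [dist_triangle w z ((6 : ℂ) + T * I)]
  have hne1 : ∀ w ∈ closedBall z (1 / 2), w ≠ 1 := by
    intro w hw h
    have hw' := hsub hw
    rw [h, mem_closedBall, dist_eq_norm] at hw'
    have := abs_im_le_norm (1 - (6 + (T : ℂ) * I))
    simp at this
    rw [abs_le] at this
    linarith [this.2]
  have hd : DiffContOnCl ℂ riemannZeta (ball z (1 / 2)) := by
    refine DifferentiableOn.diffContOnCl fun w hw ↦ ?_
    rw [closure_ball z (by norm_num)] at hw
    exact (differentiableAt_riemannZeta (hne1 w hw)).differentiableWithinAt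
  have h := Complex.norm_deriv_le_of_forall_mem_sphere_norm_le (by norm_num : (0 : ℝ) < 1 / 2) hd
    (C := (T + 15) ^ 3) fun w hw ↦ norm_riemannZeta_le_on_disc hT (hsub (sphere_subset_closedBall hw))
  linarith

/-! ## The anchors `ζ(6+iT)` and `ζ'(6+iT)` -/

/-- `Σ_{i<n} 1/(i+2)² ≤ 1` (Mathlib's `sum_Ioo_inv_sq_le`). [folklore] -/
lemma sum_range_inv_add_two_sq_le (n : ℕ) :
    ∑ i ∈ Finset.range n, (((i + 2 : ℕ) : ℝ) ^ 2)⁻¹ ≤ 1 := by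
  have h := sum_Ioo_inv_sq_le (α := ℝ) 1 (n + 2)
  rw [Finset.range_eq_Ico, Finset.sum_Ico_add' (fun j : ℕ ↦ (((j : ℕ) : ℝ) ^ 2)⁻¹) 0 n 2,
    zero_add, show Finset.Ico 2 (n + 2) = Finset.Ioo 1 (n + 2) from rfl]
  norm_num at h
  exact h

/-- `Σ_{i<n} 1/(i+4)² ≤ ½`. [folklore] -/
lemma sum_range_inv_add_four_sq_le (n : ℕ) :
    ∑ i ∈ Finset.range n, (((i + 4 : ℕ) : ℝ) ^ 2)⁻¹ ≤ 1 / 2 := by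
  have h := sum_Ioo_inv_sq_le (α := ℝ) 3 (n + 4)
  rw [Finset.range_eq_Ico, Finset.sum_Ico_add' (fun j : ℕ ↦ (((j : ℕ) : ℝ) ^ 2)⁻¹) 0 n 4,
    zero_add, show Finset.Ico 4 (n + 4) = Finset.Ioo 3 (n + 4) from rfl]
  norm_num at h ⊢
  exact h

/-- **`‖ζ(s) - 1‖ ≤ 1/16` for `Re s = 6`** (`Σ_{n≥2} n⁻⁶ ≤ (1/16) Σ_{n≥2} n⁻² ≤ 1/16`). [folklore] -/
theorem norm_riemannZeta_sub_one_le {s : ℂ} (hs : s.re = 6) : ‖riemannZeta s - 1‖ ≤ 1 / 16 := by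
  have hs1 : 1 < s.re := by rw [hs]; norm_num
  have hsum : HasSum (LSeries.term 1 s) (riemannZeta s) := LSeriesHasSum_one hs1
  have hsm : Summable (LSeries.term 1 s) := hsum.summable
  have hsplit := hsm.sum_add_tsum_nat_add 2
  rw [hsum.tsum_eq, Finset.sum_range_succ, Finset.sum_range_succ, Finset.sum_range_zero,
    zero_add, LSeries.term_zero, zero_add, LSeries.term_of_ne_zero one_ne_zero] at hsplit
  simp only [Pi.one_apply, Nat.cast_one, one_cpow, div_one] at hsplit
  have heq : riemannZeta s - 1 = ∑' n, LSeries.term 1 s (n + 2) := by rw [← hsplit]; ring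
  have hnorm : ∀ n : ℕ, ‖LSeries.term 1 s (n + 2)‖ = (((n + 2 : ℕ) : ℝ) ^ 6)⁻¹ := by
    intro n
    rw [LSeries.norm_term_eq, if_neg (by omega), Pi.one_apply, norm_one, hs,
      show (6 : ℝ) = ((6 : ℕ) : ℝ) by norm_num, Real.rpow_natCast, one_div]
  rw [heq]
  have hsm2 : Summable fun n ↦ ‖LSeries.term 1 s (n + 2)‖ := (summable_nat_add_iff 2).2 hsm.norm
  refine (norm_tsum_le_tsum_norm hsm2).trans ?_
  rw [tsum_congr hnorm]
  refine Real.tsum_le_of_sum_range_le (fun n ↦ by positivity) fun n ↦ ?_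
  calc ∑ i ∈ Finset.range n, (((i + 2 : ℕ) : ℝ) ^ 6)⁻¹
      ≤ ∑ i ∈ Finset.range n, (1 / 16) * (((i + 2 : ℕ) : ℝ) ^ 2)⁻¹ := by
        refine Finset.sum_le_sum fun i _ ↦ ?_
        have h2 : (2 : ℝ) ≤ ((i + 2 : ℕ) : ℝ) := by exact_mod_cast (by omega : 2 ≤ i + 2)
        have h4 : (4 : ℝ) ≤ ((i + 2 : ℕ) : ℝ) ^ 2 := by nlinarith
        have h16 : (16 : ℝ) ≤ ((i + 2 : ℕ) : ℝ) ^ 4 := by nlinarith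
        rw [← div_eq_mul_inv, le_div_iff₀ (by positivity), ← one_div, div_mul_eq_mul_div,
          one_mul, div_le_iff₀ (by positivity)]
        nlinarith [pow_pos (by positivity : (0 : ℝ) < ((i + 2 : ℕ) : ℝ)) 2]
    _ = (1 / 16) * ∑ i ∈ Finset.range n, (((i + 2 : ℕ) : ℝ) ^ 2)⁻¹ := by rw [Finset.mul_sum]
    _ ≤ (1 / 16) * 1 := by gcongr; exact sum_range_inv_add_two_sq_le n
    _ = 1 / 16 := by norm_num

/-- `‖ζ(s)‖ ≥ 15/16` for `Re s = 6`. [folklore] -/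
theorem norm_riemannZeta_ge {s : ℂ} (hs : s.re = 6) : 15 / 16 ≤ ‖riemannZeta s‖ := by
  have h := norm_riemannZeta_sub_one_le hs
  have := norm_sub_norm_le (1 : ℂ) (riemannZeta s)
  rw [norm_one, norm_sub_rev] at this
  linarith

/-- `ζ' = -L(log)` on `Re s > 1`: `ζ'(s) = -Σₙ (log n) n^{-s}` (Mathlib's `LSeries_deriv` for
`L 1 = ζ`). [folklore] -/
theorem deriv_riemannZeta_eq_neg_LSeries {s : ℂ} (hs : 1 < s.re) :
    deriv riemannZeta s = -LSeries (LSeries.logMul 1) s := by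
  have hev : riemannZeta =ᶠ[𝓝 s] LSeries 1 := by
    filter_upwards [(isOpen_lt continuous_const continuous_re).mem_nhds hs] with z hz
    exact (LSeries_one_eq_riemannZeta hz).symm
  rw [hev.deriv_eq]
  exact LSeries_deriv (by rw [LSeries.abscissaOfAbsConv_one]; exact_mod_cast hs)

/-- `log 3 ≤ 2 log 2 - 1/4 < 1.1363` (`log 3 = log 4 + log(3/4)`, `log(3/4) ≤ 3/4 - 1`). [folklore] -/
lemma log_three_le : Real.log 3 ≤ 1.1363 := by
  have h2 := Real.log_two_lt_d9
  have h34 : Real.log (3 / 4) ≤ 3 / 4 - 1 := Real.log_le_sub_one_of_pos (by norm_num)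
  have : Real.log 3 = 2 * Real.log 2 + Real.log (3 / 4) := by
    rw [show (3 : ℝ) = 2 ^ 2 * (3 / 4) by norm_num, Real.log_mul (by norm_num) (by norm_num),
      Real.log_pow]
    push_cast; ring
  rw [this]
  norm_num at h2 ⊢
  linarith

/-- For `m ≥ 4`: `log m / m⁶ ≤ (log 4/256)/m²` (`log x / x` decreases on `[e, ∞)`, `m⁻³ ≤ 1/64`).
[folklore] -/
lemma log_div_pow_six_le {m : ℕ} (hm : 4 ≤ m) :
    Real.log m / (m : ℝ) ^ 6 ≤ Real.log 4 / 256 * ((m : ℝ) ^ 2)⁻¹ := by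
  have hm' : (4 : ℝ) ≤ m := by exact_mod_cast hm
  have he4 : Real.exp 1 ≤ 4 := by have := Real.exp_one_lt_d9; norm_num at this; linarith
  have hanti := Real.log_div_self_antitoneOn (a := 4) (b := m) he4 (he4.trans hm') hm'
  -- `hanti : log m / m ≤ log 4 / 4`
  have hpos : (0 : ℝ) < m := by linarith
  have h64 : (64 : ℝ) ≤ (m : ℝ) ^ 3 := by
    have h16 : (16 : ℝ) ≤ (m : ℝ) ^ 2 := by nlinarith
    nlinarith
  have hlog0 : 0 ≤ Real.log m := Real.log_nonneg (by linarith)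
  have e : Real.log m / (m : ℝ) ^ 6 = (Real.log m / m) * ((m : ℝ) ^ 3)⁻¹ * ((m : ℝ) ^ 2)⁻¹ := by
    field_simp
  rw [e]
  have h1 : ((m : ℝ) ^ 3)⁻¹ ≤ 1 / 64 := by
    rw [inv_le_comm₀ (by positivity) (by norm_num)]; simpa using h64
  have hlog4 : 0 ≤ Real.log 4 / 4 := by positivity
  calc Real.log m / m * ((m : ℝ) ^ 3)⁻¹ * ((m : ℝ) ^ 2)⁻¹
      ≤ Real.log 4 / 4 * (1 / 64) * ((m : ℝ) ^ 2)⁻¹ := by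
        gcongr
    _ = Real.log 4 / 256 * ((m : ℝ) ^ 2)⁻¹ := by ring

/-- Partial sums of the tail: `Σ_{i<N} log(i+3)/(i+3)⁶ ≤ log 3/729 + log 4/512`. [folklore] -/
lemma sum_range_log_div_pow_six_le (N : ℕ) :
    ∑ i ∈ Finset.range N, Real.log ((i + 3 : ℕ) : ℝ) / (((i + 3 : ℕ) : ℝ)) ^ 6 ≤
      Real.log 3 / 729 + Real.log 4 / 512 := by
  have hl3 : 0 ≤ Real.log 3 / 729 := by positivity
  have hl4 : 0 ≤ Real.log 4 / 512 := by positivity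
  cases N with
  | zero => simp; positivity
  | succ N =>
    rw [Finset.sum_range_succ']
    have h0 : Real.log ((0 + 3 : ℕ) : ℝ) / (((0 + 3 : ℕ) : ℝ)) ^ 6 = Real.log 3 / 729 := by
      norm_num
    rw [h0, add_comm]
    gcongr
    calc ∑ i ∈ Finset.range N, Real.log ((i + 1 + 3 : ℕ) : ℝ) / (((i + 1 + 3 : ℕ) : ℝ)) ^ 6
        ≤ ∑ i ∈ Finset.range N, Real.log 4 / 256 * ((((i + 4 : ℕ) : ℝ)) ^ 2)⁻¹ := by
          refine Finset.sum_le_sum fun i _ ↦ ?_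
          rw [show i + 1 + 3 = i + 4 by ring]
          exact log_div_pow_six_le (by omega)
      _ = Real.log 4 / 256 * ∑ i ∈ Finset.range N, ((((i + 4 : ℕ) : ℝ)) ^ 2)⁻¹ := by
          rw [Finset.mul_sum]
      _ ≤ Real.log 4 / 256 * (1 / 2) := by
          gcongr
          exact sum_range_inv_add_four_sq_le N
      _ = Real.log 4 / 512 := by ring

/-- **`‖ζ'(s)‖ ≥ 1/200` for `Re s = 6`**: `ζ'(s) = -(log 2) 2^{-s} - Σ_{n≥3} (log n) n^{-s}` with
`Σ_{n≥3} (log n) n⁻⁶ ≤ log 3/729 + log 4/512 < 0.0043 < log 2/64 - 1/200`. [folklore] -/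
theorem norm_deriv_riemannZeta_ge {s : ℂ} (hs : s.re = 6) : 1 / 200 ≤ ‖deriv riemannZeta s‖ := by
  have hs1 : 1 < s.re := by rw [hs]; norm_num
  set t : ℕ → ℂ := LSeries.term (LSeries.logMul 1) s with ht
  have hsm : Summable t :=
    LSeriesSummable_logMul_of_lt_re (by rw [LSeries.abscissaOfAbsConv_one]; exact_mod_cast hs1)
  have hsplit := hsm.sum_add_tsum_nat_add 3
  have ht0 : t 0 = 0 := LSeries.term_zero _ _
  have ht1 : t 1 = 0 := by
    rw [ht, LSeries.term_of_ne_zero one_ne_zero]; simp [LSeries.logMul]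
  have ht2 : t 2 = Complex.log 2 / 2 ^ s := by
    rw [ht, LSeries.term_of_ne_zero two_ne_zero]; simp [LSeries.logMul]
  rw [Finset.sum_range_succ, Finset.sum_range_succ, Finset.sum_range_succ, Finset.sum_range_zero,
    zero_add, ht0, zero_add, ht1, zero_add] at hsplit
  have hderiv : deriv riemannZeta s = -(t 2 + ∑' n, t (n + 3)) := by
    rw [deriv_riemannZeta_eq_neg_LSeries hs1, LSeries, hsplit]
  -- the main term
  have hmain : ‖t 2‖ = Real.log 2 / 64 := by
    rw [ht, LSeries.norm_term_eq, if_neg two_ne_zero, hs,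
      show (6 : ℝ) = ((6 : ℕ) : ℝ) by norm_num, Real.rpow_natCast]
    simp only [LSeries.logMul, Pi.one_apply, mul_one]
    rw [show ((2 : ℕ) : ℂ) = ((2 : ℝ) : ℂ) by norm_num, ← Complex.ofReal_log (by norm_num),
      Complex.norm_real, Real.norm_of_nonneg (Real.log_nonneg (by norm_num))]
    norm_num
  -- the tail
  have hnorm : ∀ n : ℕ, ‖t (n + 3)‖ = Real.log ((n + 3 : ℕ) : ℝ) / (((n + 3 : ℕ) : ℝ)) ^ 6 := by
    intro n
    rw [ht, LSeries.norm_term_eq, if_neg (by omega), hs,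
      show (6 : ℝ) = ((6 : ℕ) : ℝ) by norm_num, Real.rpow_natCast]
    simp only [LSeries.logMul, Pi.one_apply, mul_one]
    rw [← Complex.natCast_log, Complex.norm_real,
      Real.norm_of_nonneg (Real.log_natCast_nonneg _)]
  have hsm3 : Summable fun n ↦ ‖t (n + 3)‖ := (summable_nat_add_iff 3).2 hsm.norm
  have htail : ‖∑' n, t (n + 3)‖ ≤ Real.log 3 / 729 + Real.log 4 / 512 := by
    refine (norm_tsum_le_tsum_norm hsm3).trans ?_
    rw [tsum_congr hnorm]
    exact Real.tsum_le_of_sum_range_le (fun n ↦ by positivity) sum_range_log_div_pow_six_le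
  -- numerics
  have hl2 := Real.log_two_gt_d9
  have hl2' := Real.log_two_lt_d9
  have hl3 := log_three_le
  have hl4 : Real.log 4 = 2 * Real.log 2 := by
    rw [show (4 : ℝ) = 2 ^ 2 by norm_num, Real.log_pow]; push_cast; ring
  rw [hderiv, norm_neg]
  have := norm_sub_norm_le (t 2) (-(∑' n, t (n + 3)))
  rw [sub_neg_eq_add, norm_neg] at this
  rw [hl4] at htail
  norm_num at hl2 hl2' hl3
  linarith

/-! ## Backlund's lemma for `ζ` and `ζ'` on horizontal segments -/

/-- The bound function `π (log(A (T+15)³)/log(13/12) + 1)` produced by Backlund's lemma with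
the discs `|z - (6+iT)| ≤ 6 < 13/2`. [folklore] -/
def lmEdgeBound (A T : ℝ) : ℝ :=
  π * (Real.log (A * (T + 15) ^ 3) / Real.log (13 / 12) + 1)

/-- `log(13/12) ≥ 1/13 > 0`. [folklore] -/
lemma log_thirteen_div_twelve_ge : (1 : ℝ) / 13 ≤ Real.log (13 / 12) := by
  have := Real.one_sub_inv_le_log_of_pos (by norm_num : (0 : ℝ) < 13 / 12)
  norm_num at this ⊢
  linarith

/-- Monotonicity of the Backlund bound in `A`. [folklore] -/
lemma lmEdgeBound_mono {A A' T : ℝ} (hA : 0 < A) (hAA' : A ≤ A') (hT : 0 ≤ T) :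
    lmEdgeBound A T ≤ lmEdgeBound A' T := by
  unfold lmEdgeBound
  have hlog : 0 < Real.log (13 / 12) := lt_of_lt_of_le (by norm_num) log_thirteen_div_twelve_ge
  have hT' : 0 < (T + 15) ^ 3 := by positivity
  gcongr

/-- **`lmEdgeBound A T ≤ 249 log T`** for `1 ≤ A ≤ 512` and `T ≥ 16`
(`log(A (T+15)³) ≤ log(4096 T³) ≤ 6 log T`, `log(13/12) ≥ 1/13`, `1 ≤ log T`, `79π < 249`).
[folklore] -/
theorem lmEdgeBound_le_log {A T : ℝ} (hA : 1 ≤ A) (hA' : A ≤ 512) (hT : 16 ≤ T) :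
    lmEdgeBound A T ≤ 249 * Real.log T := by
  have hlog13 := log_thirteen_div_twelve_ge
  have hlog13pos : 0 < Real.log (13 / 12) := lt_of_lt_of_le (by norm_num) hlog13
  have hT0 : 0 < T := by linarith
  have hlogT : Real.log 16 ≤ Real.log T := Real.log_le_log (by norm_num) hT
  have hlog16 : (1 : ℝ) ≤ Real.log 16 := by
    rw [show (16 : ℝ) = 2 ^ 4 by norm_num, Real.log_pow]
    have := Real.log_two_gt_d9
    norm_num at this ⊢
    linarith
  have h1 : Real.log (A * (T + 15) ^ 3) ≤ 6 * Real.log T := by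
    have hle : A * (T + 15) ^ 3 ≤ 16 ^ 3 * T ^ 3 := by
      have h3 : (T + 15) ^ 3 ≤ (2 * T) ^ 3 := by gcongr; linarith
      have h3' : 0 ≤ (T + 15) ^ 3 := by positivity
      calc A * (T + 15) ^ 3 ≤ 512 * (2 * T) ^ 3 := by gcongr
        _ = 16 ^ 3 * T ^ 3 := by ring
    calc Real.log (A * (T + 15) ^ 3) ≤ Real.log (16 ^ 3 * T ^ 3) :=
          Real.log_le_log (by positivity) hle
      _ = 3 * Real.log 16 + 3 * Real.log T := by
          rw [Real.log_mul (by norm_num) (by positivity), Real.log_pow, Real.log_pow]; push_cast; ring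
      _ ≤ 6 * Real.log T := by linarith
  have h2 : Real.log (A * (T + 15) ^ 3) / Real.log (13 / 12) ≤ 78 * Real.log T := by
    rw [div_le_iff₀ hlog13pos]
    have : 0 ≤ Real.log T := by linarith
    nlinarith
  unfold lmEdgeBound
  have hπ := Real.pi_lt_d4
  have hπ0 := Real.pi_pos
  have h0 : 0 ≤ Real.log T := by linarith
  have h3 : Real.log (A * (T + 15) ^ 3) / Real.log (13 / 12) + 1 ≤ 79 * Real.log T := by
    linarith
  calc π * (Real.log (A * (T + 15) ^ 3) / Real.log (13 / 12) + 1) ≤ π * (79 * Real.log T) := by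
        gcongr
    _ ≤ 3.1416 * (79 * Real.log T) := by gcongr
    _ ≤ 249 * Real.log T := by nlinarith

/-- Points of the disc `|z - (6+iT)| ≤ 13/2` are not the pole (`T ≥ 8`). [folklore] -/
lemma ne_one_of_mem_closedBall {T : ℝ} (hT : 8 ≤ T) {z : ℂ}
    (hz : z ∈ closedBall ((6 : ℂ) + T * I) (13 / 2)) : z ≠ 1 := by
  intro h
  rw [h, mem_closedBall, dist_eq_norm] at hz
  have := abs_im_le_norm (1 - (6 + (T : ℂ) * I))
  simp at this
  rw [abs_le] at this
  linarith [this.2]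

/-- **Backlund's lemma for `ζ`** (LM §2 / Titchmarsh §9.4): for `T ≥ 8`, `0 ≤ b ≤ 12` and
`ζ ≠ 0` on `[0,b] × {T}`, `|Im ∫_0^b ζ'/ζ(x+iT) dx| ≤ lmEdgeBound (16/15) T` (disc
`|z-(6+iT)| ≤ 13/2 ⊃ |z-(6+iT)| ≤ 6 ⊃ [0,b]×{T}`, `‖ζ‖ ≤ (T+15)³`, `‖ζ(6+iT)‖ ≥ 15/16`).
[cite: LevinsonMontgomery1974, §2] -/
theorem abs_im_integral_logDeriv_riemannZeta_le {T b : ℝ} (hT : 8 ≤ T) (hb0 : 0 ≤ b)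
    (hb : b ≤ 12) (h0 : ∀ x ∈ Icc 0 b, riemannZeta (x + T * I) ≠ 0) :
    |(∫ x : ℝ in (0 : ℝ)..b, deriv riemannZeta (x + T * I) / riemannZeta (x + T * I)).im| ≤
      lmEdgeBound (16 / 15) T := by
  have e6 : ((6 : ℝ) : ℂ) = 6 := by norm_num
  have hM : (1 : ℝ) ≤ (T + 15) ^ 3 := one_le_pow₀ (by linarith)
  have hg : ∀ z ∈ closedBall (((6 : ℝ) : ℂ) + T * I) (13 / 2), AnalyticAt ℂ riemannZeta z := by
    intro z hz
    rw [e6] at hz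
    exact analyticOn_riemannZeta z (ne_one_of_mem_closedBall hT hz)
  have hgM : ∀ z ∈ closedBall (((6 : ℝ) : ℂ) + T * I) (13 / 2), ‖riemannZeta z‖ ≤ (T + 15) ^ 3 := by
    intro z hz
    rw [e6] at hz
    exact norm_riemannZeta_le_on_disc hT (closedBall_subset_closedBall (by norm_num) hz)
  have hanchor : 15 / 16 ≤ ‖riemannZeta ((6 : ℝ) + T * I)‖ := norm_riemannZeta_ge (by simp)
  have hc : riemannZeta ((6 : ℝ) + T * I) ≠ 0 := by
    intro h; rw [h, norm_zero] at hanchor; linarith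
  have h := Literature.Analysis.Complex.abs_im_integral_logDeriv_le_backlund (g := riemannZeta) (c := 6) (y := T)
    (r := 6) (R := 13 / 2) (M := (T + 15) ^ 3) (a := 0) (b := b) (by norm_num) (by norm_num) hM
    hg hgM hc hb0 (by norm_num) (by linarith) h0
  refine h.trans ?_
  unfold lmEdgeBound
  have hlog13pos : 0 < Real.log (13 / 12) := lt_of_lt_of_le (by norm_num) log_thirteen_div_twelve_ge
  rw [show (13 : ℝ) / 2 / 6 = 13 / 12 by norm_num]
  gcongr
  · -- `(T+15)³/‖ζ(6+iT)‖ ≤ (16/15)(T+15)³`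
    rw [div_le_iff₀ (by linarith)]
    nlinarith

/-- **Backlund's lemma for `ζ'`**: for `T ≥ 8`, `0 ≤ b ≤ 12` and `ζ' ≠ 0` on `[0,b] × {T}`,
`|Im ∫_0^b ζ''/ζ'(x+iT) dx| ≤ lmEdgeBound 400 T` (`‖ζ'‖ ≤ 2(T+15)³`, `‖ζ'(6+iT)‖ ≥ 1/200`).
[cite: LevinsonMontgomery1974, §2] -/
theorem abs_im_integral_logDeriv_deriv_riemannZeta_le {T b : ℝ} (hT : 8 ≤ T) (hb0 : 0 ≤ b)
    (hb : b ≤ 12) (h0 : ∀ x ∈ Icc 0 b, deriv riemannZeta (x + T * I) ≠ 0) :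
    |(∫ x : ℝ in (0 : ℝ)..b, deriv (deriv riemannZeta) (x + T * I) /
        deriv riemannZeta (x + T * I)).im| ≤ lmEdgeBound 400 T := by
  have e6 : ((6 : ℝ) : ℂ) = 6 := by norm_num
  have hM : (1 : ℝ) ≤ 2 * (T + 15) ^ 3 := by
    have : (1 : ℝ) ≤ (T + 15) ^ 3 := one_le_pow₀ (by linarith)
    linarith
  have hg : ∀ z ∈ closedBall (((6 : ℝ) : ℂ) + T * I) (13 / 2),
      AnalyticAt ℂ (deriv riemannZeta) z := by
    intro z hz
    rw [e6] at hz
    exact analyticOnNhd_deriv_riemannZeta z (ne_one_of_mem_closedBall hT hz)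
  have hgM : ∀ z ∈ closedBall (((6 : ℝ) : ℂ) + T * I) (13 / 2),
      ‖deriv riemannZeta z‖ ≤ 2 * (T + 15) ^ 3 := by
    intro z hz
    rw [e6] at hz
    exact norm_deriv_riemannZeta_le_on_disc hT hz
  have hanchor : 1 / 200 ≤ ‖deriv riemannZeta ((6 : ℝ) + T * I)‖ :=
    norm_deriv_riemannZeta_ge (by simp)
  have hc : deriv riemannZeta ((6 : ℝ) + T * I) ≠ 0 := by
    intro h; rw [h, norm_zero] at hanchor; linarith
  have h := Literature.Analysis.Complex.abs_im_integral_logDeriv_le_backlund (g := deriv riemannZeta) (c := 6)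
    (y := T) (r := 6) (R := 13 / 2) (M := 2 * (T + 15) ^ 3) (a := 0) (b := b) (by norm_num)
    (by norm_num) hM hg hgM hc hb0 (by norm_num) (by linarith) h0
  refine h.trans ?_
  unfold lmEdgeBound
  have hlog13pos : 0 < Real.log (13 / 12) := lt_of_lt_of_le (by norm_num) log_thirteen_div_twelve_ge
  rw [show (13 : ℝ) / 2 / 6 = 13 / 12 by norm_num]
  have hT' : 0 < (T + 15) ^ 3 := by positivity
  gcongr
  · rw [div_le_iff₀ (by linarith)]
    nlinarith

end Literature.NumberTheory.LFunctions

end
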